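import Summits.RiemannHypothesis.RiemannHypothesis.Theses.IntegerScrew
import Literature.NumberTheory.LFunctions.ZetaScrewThm12Proofs
import HarnessLib

/-!
# Route IntegerScrew — `FloorOfRH` (stmt-RiemannHypothesis-15762), screw side of stub S3
`stub_combDominated` (crux `ScrewPolyFloor`, stmt-RiemannHypothesis-15757, line `weil_comb_floor`)

THE GRAM EXPANSION OF THE SCREW FORM OVER THE ZEROS (under RH).  For real `y` with
`Σ_{1 ≤ m ≤ M} y_m = 0`,
`Σ_{2≤m,m'≤M} G(log m, log m') y_m y_m' = Σ_ρ m(ρ) |P_y(ρ)|² / γ²`,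
`P_y(ρ) = Σ_{1≤m≤M} y_m m^{ρ−1/2}` (`= Σ y_m m^{iγ}` under RH), as a `HasSum` over the non-trivial
zeros (`ZetaZeros.riemannZetaNontrivialZeros`, multiplicity `riemannZetaZeroOrder`).
From `ZetaScrewThm12.hasSum_kernel` (Suzuki2023 (1.9), PROVED):
`G(t,u) = Σ_ρ m(ρ)γ⁻²(1 − cos γt − cos γu + cos γ(t−u))`, and the finite-sum algebra
`Σ_{m,m'≥2} y_m y_m' (…) = (Σ_{m≥2} y_m(1 − cos γ log m))² + (Σ_{m≥2} y_m sin γ log m)² = |P_y(ρ)|²`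
(the coordinate `m = 1` absorbs the constant term because `Σ y = 0` and `1^{iγ} = 1`).
-/

-- `Summit.RiemannHypothesis.RiemannHypothesis.…` duplicates `RiemannHypothesis` BY DESIGN (D-0017).
set_option linter.dupNamespace false

noncomputable section

namespace Summit.RiemannHypothesis.RiemannHypothesis.Theorems

open Literature.NumberTheory.LFunctions Complex
open scoped BigOperators
open Finset

namespace IntegerScrew

/-- Under RH, for a non-trivial zero `ρ` and `m ≥ 1`: `m^{ρ − 1/2} = cos(γ log m) + i sin(γ log m)`,
`γ = Im ρ`. -/
theorem natCast_cpow_sub_half_of_RH (hRH : RiemannHypothesis)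
    (ρ : ZetaZeros.riemannZetaNontrivialZeros) {m : ℕ} (hm : 1 ≤ m) :
    (m : ℂ) ^ ((ρ : ℂ) - 1 / 2) =
      (Real.cos ((ρ : ℂ).im * Real.log m) : ℂ) + (Real.sin ((ρ : ℂ).im * Real.log m) : ℂ) * I := by
  have hm0 : (m : ℂ) ≠ 0 := Nat.cast_ne_zero.2 (by omega)
  rw [ZetaScrewThm17.sub_half_eq_of_RH hRH ρ.2, Complex.cpow_def_of_ne_zero hm0,
    ← Complex.natCast_log,
    show ((Real.log m : ℝ) : ℂ) * (((ρ : ℂ).im : ℂ) * I) = (((ρ : ℂ).im * Real.log m : ℝ) : ℂ) * I by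
      push_cast; ring,
    Complex.exp_mul_I, ← Complex.ofReal_cos, ← Complex.ofReal_sin]

/-- Real and imaginary parts of the Dirichlet polynomial `P_y(ρ) = Σ_{m ≤ M} y_m m^{ρ−1/2}` under RH. -/
theorem dirichletPoly_re_im_of_RH (hRH : RiemannHypothesis)
    (ρ : ZetaZeros.riemannZetaNontrivialZeros) (M : ℕ) (y : ℕ → ℝ) :
    (∑ m ∈ Icc 1 M, ((y m : ℝ) : ℂ) * (m : ℂ) ^ ((ρ : ℂ) - 1 / 2)).re =
        ∑ m ∈ Icc 1 M, y m * Real.cos ((ρ : ℂ).im * Real.log m) ∧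
      (∑ m ∈ Icc 1 M, ((y m : ℝ) : ℂ) * (m : ℂ) ^ ((ρ : ℂ) - 1 / 2)).im =
        ∑ m ∈ Icc 1 M, y m * Real.sin ((ρ : ℂ).im * Real.log m) := by
  have hterm : ∀ m ∈ Icc 1 M, ((y m : ℝ) : ℂ) * (m : ℂ) ^ ((ρ : ℂ) - 1 / 2) =
      ((y m * Real.cos ((ρ : ℂ).im * Real.log m) : ℝ) : ℂ) +
        ((y m * Real.sin ((ρ : ℂ).im * Real.log m) : ℝ) : ℂ) * I := by
    intro m hm
    rw [natCast_cpow_sub_half_of_RH hRH ρ (Finset.mem_Icc.mp hm).1]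
    push_cast
    ring
  rw [Finset.sum_congr rfl hterm, Complex.re_sum, Complex.im_sum]
  constructor
  · refine Finset.sum_congr rfl fun m _ => ?_
    simp only [Complex.add_re, Complex.mul_re, Complex.ofReal_re, Complex.ofReal_im, Complex.I_re,
      Complex.I_im, mul_zero, zero_mul, sub_zero, add_zero]
  · refine Finset.sum_congr rfl fun m _ => ?_
    simp only [Complex.add_im, Complex.mul_im, Complex.ofReal_re, Complex.ofReal_im, Complex.I_re,
      Complex.I_im, mul_zero, mul_one, add_zero, zero_add]

/-- **Gram expansion of the screw form over the zeros (under RH).**  For real `y` with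
`Σ_{1≤m≤M} y_m = 0`:
`HasSum (ρ ↦ m(ρ)/γ² · ‖Σ_{1≤m≤M} y_m m^{ρ−1/2}‖²) (Σ_{2≤m,m'≤M} G(log m, log m') y_m y_m')`. -/
theorem hasSum_screwForm_of_RH (hRH : RiemannHypothesis) (M : ℕ) (y : ℕ → ℝ)
    (hy : ∑ m ∈ Icc 1 M, y m = 0) :
    HasSum (fun ρ : ZetaZeros.riemannZetaNontrivialZeros =>
      (riemannZetaZeroOrder (ρ : ℂ) : ℝ) / (ρ : ℂ).im ^ 2 *
        ‖∑ m ∈ Icc 1 M, ((y m : ℝ) : ℂ) * (m : ℂ) ^ ((ρ : ℂ) - 1 / 2)‖ ^ 2)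
      (∑ m ∈ Icc 2 M, ∑ m' ∈ Icc 2 M,
        zetaScrewKernel (Real.log m) (Real.log m') * (y m * y m')) := by
  have hQ : HasSum (fun ρ : ZetaZeros.riemannZetaNontrivialZeros => ∑ m ∈ Icc 2 M, ∑ m' ∈ Icc 2 M,
      (riemannZetaZeroOrder (ρ : ℂ) : ℝ) / (ρ : ℂ).im ^ 2 *
        (1 - Real.cos ((ρ : ℂ).im * Real.log m) - Real.cos ((ρ : ℂ).im * Real.log m')
          + Real.cos ((ρ : ℂ).im * Real.log m - (ρ : ℂ).im * Real.log m')) * (y m * y m'))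
      (∑ m ∈ Icc 2 M, ∑ m' ∈ Icc 2 M,
        zetaScrewKernel (Real.log m) (Real.log m') * (y m * y m')) :=
    hasSum_sum fun m _ => hasSum_sum fun m' _ =>
      (ZetaScrewThm12.hasSum_kernel hRH (Real.log m) (Real.log m')).mul_right _
  refine hQ.congr_fun fun ρ => ?_
  set γ : ℝ := (ρ : ℂ).im with hγ
  set mρ : ℝ := (riemannZetaZeroOrder (ρ : ℂ) : ℝ) with hmρ
  -- the finite-sum algebra (as in `ZetaScrewThm12.sum_sum_kernel_nonneg`)
  have key : ∑ m ∈ Icc 2 M, ∑ m' ∈ Icc 2 M, mρ / γ ^ 2 *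
      (1 - Real.cos (γ * Real.log m) - Real.cos (γ * Real.log m')
        + Real.cos (γ * Real.log m - γ * Real.log m')) * (y m * y m')
      = mρ / γ ^ 2 *
        ((∑ m ∈ Icc 2 M, y m * (1 - Real.cos (γ * Real.log m))) *
            (∑ m ∈ Icc 2 M, y m * (1 - Real.cos (γ * Real.log m)))
          + (∑ m ∈ Icc 2 M, y m * Real.sin (γ * Real.log m)) *
            (∑ m ∈ Icc 2 M, y m * Real.sin (γ * Real.log m))) := by
    simp_rw [Real.cos_sub]
    rw [Finset.sum_mul_sum, Finset.sum_mul_sum, ← Finset.sum_add_distrib, Finset.mul_sum]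
    refine Finset.sum_congr rfl fun i _ => ?_
    rw [← Finset.sum_add_distrib, Finset.mul_sum]
    refine Finset.sum_congr rfl fun j _ => ?_
    ring
  rw [key]
  -- pass from `Icc 2 M` to `Icc 1 M` (the `m = 1` terms vanish: `cos 0 = 1`, `sin 0 = 0`)
  have hsub : Icc 2 M ⊆ Icc 1 M := fun k hk => by
    simp only [Finset.mem_Icc] at hk ⊢; omega
  have hout : ∀ k, k ∈ Icc 1 M → k ∉ Icc 2 M → k = 1 := fun k hk hk' => by
    simp only [Finset.mem_Icc, not_and, not_le] at hk hk'; omega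
  have hC : ∑ m ∈ Icc 2 M, y m * (1 - Real.cos (γ * Real.log m)) =
      ∑ m ∈ Icc 1 M, y m * (1 - Real.cos (γ * Real.log m)) :=
    Finset.sum_subset hsub fun k hk hk' => by rw [hout k hk hk']; simp
  have hS : ∑ m ∈ Icc 2 M, y m * Real.sin (γ * Real.log m) =
      ∑ m ∈ Icc 1 M, y m * Real.sin (γ * Real.log m) :=
    Finset.sum_subset hsub fun k hk hk' => by rw [hout k hk hk']; simp
  have hC' : ∑ m ∈ Icc 1 M, y m * (1 - Real.cos (γ * Real.log m)) =
      -∑ m ∈ Icc 1 M, y m * Real.cos (γ * Real.log m) := by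
    simp only [mul_sub, mul_one, Finset.sum_sub_distrib, hy, zero_sub]
  obtain ⟨hre, him⟩ := dirichletPoly_re_im_of_RH hRH ρ M y
  rw [hC, hS, hC', Complex.sq_norm, Complex.normSq_apply, hre, him]
  ring

end IntegerScrew

end Summit.RiemannHypothesis.RiemannHypothesis.Theorems

end
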